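import Summits.CriticalPhenomena.PercolationContinuityZ3.Theorems.Transplant.CayleyCylinderStrictDir
import Summits.CriticalPhenomena.PercolationContinuityZ3.Theorems.Transplant.CayleySkeletonNoFC
import HarnessLib

/-!
# The abstract Cayley-graph theorem for LETTERS-ONLY 2-step nilpotent generating systems: `CayleyNeg₁`, `CayleySign₁`

builds on p205010 (kernel theorem, internal audit signed; external expert review pending).
Lane `prim-bschramm`, seat `prim-bschramm-p4` gen 10 (PART C3 of `P4-GENERAL.md`, "tier 2″").  Helper file
(`--supports stmt-CriticalPhenomena-4575 --as helper`).

`CayleySign₀` (file `CayleySkeletonNoFC`) needs `ker φ = ⟨S ∩ ker φ⟩`, false for the letters-only Cayley graph `fnGraph m` of `N_{m,2}`.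
`CayleySign₁` replaces it by: `S` symmetric and `ker φ` generated, for each sign `σ = ±1`, by the kernel letters and the corner-admissible
commutator words `a⁻¹b⁻¹ab` (`a, b ∈ S`, `φ a ≠ φ b ∈ {0, e₀, σe₁}`) — true in every 2-step nilpotent group whose kernel is generated by
kernel letters and commutators of letter pairs.  Outputs: the planar `{±1}`-skeleton (`CayleyNeg₁.skeleton`; cylinders `C_ℓ`, `ℓ ≥ 1`,
are connected through columns, rows and admissible words), **Φ2 at every `p ≤ p_c`** (`cylSubcritical_of_le`, from file VII's
`CylData₁.theta_cyl_criticalProb_eq_zero`), and **`CayleySign₁.theta_eq_zero_of_le : θ_g(p) = 0` for every `p ≤ p_c` at every vertex**, unconditionally;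
the `{±1}` version modulo N1 (`CayleyNeg₁.theta_eq_zero_of_le_of_negNode₁`).
-/

noncomputable section

namespace Summit.CriticalPhenomena.PercolationContinuityZ3.Theorems.Transplant

open SimpleGraph Walk Literature.Probability.LatticeModels Literature.Probability.Percolation
open Literature.Barriers.CriticalPhenomena (countable_of_connected_of_locallyFinite)
open scoped Classical

/-! ## §1 `CayleyNeg₁` -/

/-- **INPUT, `{±1}` version, letters only**: additive `φ : Γ → ℤ²` of unit range on `S` with unit steps in `S`, `S` symmetric, an
`S`-preserving automorphism `ν` with `φν = −φ`, and `ker φ` generated by kernel letters and corner-admissible commutator words of each sign.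
[cite: KozmaNitzan2024, §4 p. 16 (Lemma 8)] [cite: BenjaminiSchramm1996, §2; Conj. 4] -/
structure CayleyNeg₁ (Γ : Type) [Group Γ] (S : Finset Γ) where
  /-- the skeleton homomorphism `φ : Γ → ℤ²` -/
  φ : Γ → Site 2
  /-- additivity -/
  map_mul : ∀ g h : Γ, φ (g * h) = φ g + φ h
  /-- generators have sup-norm `≤ 1` -/
  lip : ∀ s ∈ S, ∀ i : Fin 2, |φ s i| ≤ 1
  /-- unit steps: some generator maps to each basis vector -/
  step : ∀ i : Fin 2, ∃ s ∈ S, φ s = Pi.single i 1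
  /-- `S` is symmetric -/
  inv_mem : ∀ s ∈ S, s⁻¹ ∈ S
  /-- the reversing automorphism -/
  ν : Γ ≃* Γ
  /-- `ν` preserves the generating system -/
  ν_mem : ∀ s, ν s ∈ S ↔ s ∈ S
  /-- `φ ∘ ν = −φ` -/
  ν_φ : ∀ g, φ (ν g) = -φ g
  /-- the corner-admissible kernel criterion, both signs -/
  ker_adm : ∀ σ : ℤ, σ = 1 ∨ σ = -1 → ∀ k : Γ, φ k = 0 → k ∈ Subgroup.closure (CayCyl.admGen φ S σ)

namespace CayleyNeg₁

variable {Γ : Type} [Group Γ] {S : Finset Γ} (D : CayleyNeg₁ Γ S)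

/-- The cylinder data of a `CayleyNeg₁`. [folklore] -/
def cylData : CayCyl.CylData₁ Γ S where
  φ := D.φ
  map_mul := D.map_mul
  lip := D.lip
  s₀ := Classical.choose (D.step 0)
  s₀_mem := (Classical.choose_spec (D.step 0)).1
  φ_s₀ := (Classical.choose_spec (D.step 0)).2
  s₁ := Classical.choose (D.step 1)
  s₁_mem := (Classical.choose_spec (D.step 1)).1
  φ_s₁ := (Classical.choose_spec (D.step 1)).2
  inv_mem := D.inv_mem
  ker_adm := D.ker_adm

/-- `φ 1 = 0`. [folklore] -/
theorem φ_one : D.φ 1 = 0 := D.cylData.enl.φ_one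

/-! ### Connectivity of the cylinders `C_ℓ`, `ℓ ≥ 1` -/

/-- `cylData.φ = φ`. [folklore] -/
@[simp] theorem cylData_φ : D.cylData.φ = D.φ := rfl

/-- A power walk whose vertices stay in a cylinder gives reachability in the cylinder graph. [folklore] -/
theorem reachable_of_powWalk (ℓ : ℕ) {t : Γ} (hadj : ∀ g : Γ, (mulCayley (S : Set Γ)).Adj g (g * t)) (v : D.cylData.enl.V ℓ) (n : ℕ)
    (hmem : ∀ z ∈ (CayCyl.powWalk S hadj v.1 n).support, z ∈ D.cylData.enl.V ℓ) :
    (D.cylData.cylG ℓ).Reachable v ⟨v.1 * t ^ n, hmem _ (Walk.end_mem_support _)⟩ :=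
  ⟨(CayCyl.powWalk S hadj v.1 n).induce _ hmem⟩

/-- Reduce the `0`-coordinate to `0` inside a cylinder (walk along the `s₀`-column). [folklore] -/
theorem reach_col (ℓ : ℕ) (v : D.cylData.enl.V ℓ) :
    ∃ g : Γ, ∃ hg : g ∈ D.cylData.enl.V ℓ, D.φ g 0 = 0 ∧ D.φ g 1 = D.φ v.1 1 ∧ (D.cylData.cylG ℓ).Reachable v ⟨g, hg⟩ := by
  have hv := D.cylData.memV.1 v.2; rw [abs_le, abs_le, cylData_φ] at hv
  by_cases h0 : 0 ≤ D.φ v.1 0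
  · obtain ⟨n, hn⟩ : ∃ n : ℕ, (n : ℤ) = D.φ v.1 0 := ⟨(D.φ v.1 0).toNat, Int.toNat_of_nonneg h0⟩
    have hc : ∀ i : ℕ, D.φ (v.1 * D.cylData.enl.s₀⁻¹ ^ i) 0 = D.φ v.1 0 - i ∧ D.φ (v.1 * D.cylData.enl.s₀⁻¹ ^ i) 1 = D.φ v.1 1 :=
      fun i => by simpa only [CayCyl.CylData₁.enl_φ, cylData_φ] using D.cylData.enl.φ_s₀inv_pow v.1 i
    have hmem : ∀ z ∈ (CayCyl.powWalk S (fun g => CayCyl.adj_mul_of_mem S (t := D.cylData.enl.s₀⁻¹)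
        (Or.inl (D.cylData.inv_mem _ D.cylData.s₀_mem)) (inv_ne_one.2 D.cylData.enl.s₀_ne_one) g) v.1 n).support,
        z ∈ D.cylData.enl.V ℓ := by
      intro z hz
      obtain ⟨i, hi, rfl⟩ := (CayCyl.mem_support_powWalk _).1 hz
      have hi' : (i : ℤ) ≤ n := by exact_mod_cast hi
      rw [D.cylData.memV, cylData_φ, (hc i).1, (hc i).2, abs_le, abs_le]; omega
    exact ⟨_, hmem _ (Walk.end_mem_support _), by rw [(hc n).1]; omega, (hc n).2, D.reachable_of_powWalk ℓ _ v n hmem⟩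
  · obtain ⟨n, hn⟩ : ∃ n : ℕ, (n : ℤ) = -D.φ v.1 0 := ⟨(-D.φ v.1 0).toNat, Int.toNat_of_nonneg (by omega)⟩
    have hc : ∀ i : ℕ, D.φ (v.1 * D.cylData.enl.s₀ ^ i) 0 = D.φ v.1 0 + i ∧ D.φ (v.1 * D.cylData.enl.s₀ ^ i) 1 = D.φ v.1 1 :=
      fun i => by simpa only [CayCyl.CylData₁.enl_φ, cylData_φ] using D.cylData.enl.φ_s₀_pow v.1 i
    have hmem : ∀ z ∈ (CayCyl.powWalk S (fun g => CayCyl.adj_mul_of_mem S (t := D.cylData.enl.s₀)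
        (Or.inl D.cylData.s₀_mem) D.cylData.enl.s₀_ne_one g) v.1 n).support, z ∈ D.cylData.enl.V ℓ := by
      intro z hz
      obtain ⟨i, hi, rfl⟩ := (CayCyl.mem_support_powWalk _).1 hz
      have hi' : (i : ℤ) ≤ n := by exact_mod_cast hi
      rw [D.cylData.memV, cylData_φ, (hc i).1, (hc i).2, abs_le, abs_le]; omega
    exact ⟨_, hmem _ (Walk.end_mem_support _), by rw [(hc n).1]; omega, (hc n).2, D.reachable_of_powWalk ℓ _ v n hmem⟩

/-- Reduce the `1`-coordinate to `0` inside a cylinder, keeping the `0`-coordinate (walk along the `s₁`-row). [folklore] -/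
theorem reach_row (ℓ : ℕ) (v : D.cylData.enl.V ℓ) (h0 : D.φ v.1 0 = 0) :
    ∃ k : Γ, ∃ hk : k ∈ D.cylData.enl.V ℓ, D.φ k = 0 ∧ (D.cylData.cylG ℓ).Reachable v ⟨k, hk⟩ := by
  have hv := D.cylData.memV.1 v.2; rw [abs_le, abs_le, cylData_φ] at hv
  have h1 : (1 : ℤ) = 1 ∨ (1 : ℤ) = -1 := Or.inl rfl
  have zero_of : ∀ g : Γ, D.φ g 0 = 0 → D.φ g 1 = 0 → D.φ g = 0 := fun g ha hb => by
    funext j; fin_cases j <;> assumption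
  by_cases hs : 0 ≤ D.φ v.1 1
  · obtain ⟨n, hn⟩ : ∃ n : ℕ, (n : ℤ) = D.φ v.1 1 := ⟨(D.φ v.1 1).toNat, Int.toNat_of_nonneg hs⟩
    have hc : ∀ i : ℕ, D.φ (v.1 * (D.cylData.t 1)⁻¹ ^ i) 0 = D.φ v.1 0 ∧ D.φ (v.1 * (D.cylData.t 1)⁻¹ ^ i) 1 = D.φ v.1 1 - 1 * i :=
      fun i => by simpa only [cylData_φ] using D.cylData.φ_t_inv_pow h1 v.1 i
    have hmem : ∀ z ∈ (CayCyl.powWalk S (D.cylData.adj_t_inv 1) v.1 n).support, z ∈ D.cylData.enl.V ℓ := by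
      intro z hz
      obtain ⟨i, hi, rfl⟩ := (CayCyl.mem_support_powWalk _).1 hz
      have hi' : (i : ℤ) ≤ n := by exact_mod_cast hi
      rw [D.cylData.memV, cylData_φ, (hc i).1, (hc i).2, abs_le, abs_le]; omega
    exact ⟨_, hmem _ (Walk.end_mem_support _), zero_of _ (by rw [(hc n).1, h0]) (by rw [(hc n).2]; omega),
      D.reachable_of_powWalk ℓ _ v n hmem⟩
  · obtain ⟨n, hn⟩ : ∃ n : ℕ, (n : ℤ) = -D.φ v.1 1 := ⟨(-D.φ v.1 1).toNat, Int.toNat_of_nonneg (by omega)⟩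
    have hc : ∀ i : ℕ, D.φ (v.1 * D.cylData.t 1 ^ i) 0 = D.φ v.1 0 ∧ D.φ (v.1 * D.cylData.t 1 ^ i) 1 = D.φ v.1 1 + 1 * i :=
      fun i => by simpa only [cylData_φ] using D.cylData.φ_t_pow h1 v.1 i
    have hmem : ∀ z ∈ (CayCyl.powWalk S (D.cylData.adj_t 1) v.1 n).support, z ∈ D.cylData.enl.V ℓ := by
      intro z hz
      obtain ⟨i, hi, rfl⟩ := (CayCyl.mem_support_powWalk _).1 hz
      have hi' : (i : ℤ) ≤ n := by exact_mod_cast hi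
      rw [D.cylData.memV, cylData_φ, (hc i).1, (hc i).2, abs_le, abs_le]; omega
    exact ⟨_, hmem _ (Walk.end_mem_support _), zero_of _ (by rw [(hc n).1, h0]) (by rw [(hc n).2]; omega),
      D.reachable_of_powWalk ℓ _ v n hmem⟩

/-- A kernel element inside `C_ℓ`, `ℓ ≥ 1`, is joined to `1` inside `C_ℓ` (admissible word: heights in `{0,−1}²`). [folklore] -/
theorem reach_one {ℓ : ℕ} (hℓ : 1 ≤ ℓ) {k : Γ} (hk : D.φ k = 0) (hkV : k ∈ D.cylData.enl.V ℓ) :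
    (D.cylData.cylG ℓ).Reachable ⟨k, hkV⟩ ⟨1, D.cylData.one_mem_V ℓ⟩ := by
  have h1 : (1 : ℤ) = 1 ∨ (1 : ℤ) = -1 := Or.inl rfl
  have hmem : ∀ z ∈ (D.cylData.admWalk h1 k hk).support, z ∈ D.cylData.enl.V ℓ := by
    intro z hz
    have h := (D.cylData.admWalk_good h1 k hk).1 z hz
    rw [D.cylData.φ_one₁, sub_zero, cylData_φ] at h
    have hℓ' : (1 : ℤ) ≤ ℓ := by exact_mod_cast hℓ
    rw [D.cylData.memV, cylData_φ, abs_le, abs_le]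
    obtain ⟨ha | ha, hb | hb⟩ := h <;> rw [ha, hb] <;> omega
  exact Reachable.symm ⟨(D.cylData.admWalk h1 k hk).induce _ hmem⟩

/-- **The cylinders `C_ℓ`, `ℓ ≥ 1`, of a `CayleyNeg₁` are connected.** [folklore] -/
theorem cylG_connected {ℓ : ℕ} (hℓ : 1 ≤ ℓ) : (D.cylData.cylG ℓ).Connected := by
  have key : ∀ v : D.cylData.enl.V ℓ, (D.cylData.cylG ℓ).Reachable v ⟨1, D.cylData.one_mem_V ℓ⟩ := by
    intro v
    obtain ⟨g, hg, hg0, -, hr⟩ := D.reach_col ℓ v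
    obtain ⟨k, hk, hk0, hr'⟩ := D.reach_row ℓ ⟨g, hg⟩ hg0
    exact (hr.trans hr').trans (D.reach_one hℓ hk0 hk)
  haveI : Nonempty (D.cylData.enl.V ℓ) := ⟨⟨1, D.cylData.one_mem_V ℓ⟩⟩
  exact ⟨fun u v => (key u).trans (key v).symm⟩

/-- **THE SKELETON OF A `CayleyNeg₁`**: one type (the identity), left multiplications as frames, `ν` as the central inversion, degree
bound `2|S|`, unit steps, cylinders connected for `ℓ ≥ 1`. [cite: KozmaNitzan2024, §4 p. 16 (Lemma 8)] [cite: BenjaminiSchramm1996, §2] -/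
def skeleton : PlanarSkeletonNeg (mulCayley (S : Set Γ)) where
  φ := D.φ
  lip := fun _ _ h i => by rw [abs_sub_comm]; exact D.cylData.enl.lip_adj (D.cylData.adj_Sp h) i
  types := {1}
  frame := fun v => ⟨1, Finset.mem_singleton_self 1, leftMulIso S v, mul_one v, fun w => by
    show D.φ (v * w) = D.φ w + (D.φ v - D.φ 1)
    rw [D.map_mul, φ_one, sub_zero, add_comm]⟩
  neg := fun t ht => by
    rw [Finset.mem_singleton] at ht
    subst ht
    refine ⟨autOfMulEquiv S D.ν D.ν_mem, map_one D.ν, fun w => ?_⟩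
    show D.φ (D.ν w) - D.φ 1 = -(D.φ w - D.φ 1)
    rw [φ_one, sub_zero, sub_zero, D.ν_φ]
  Δ := 2 * S.card
  degree_le := degree_mulCayley_le S
  step := fun v i σ => by
    obtain ⟨s, hs, hφ⟩ := D.step i
    have hs1 : s ≠ 1 := by
      intro h
      have h0 := congrFun hφ i
      rw [h, φ_one] at h0
      simp at h0
    rcases Int.units_eq_one_or σ with rfl | rfl
    · exact ⟨v * s, CayCyl.adj_mul_of_mem S (Or.inl hs) hs1 v, by rw [D.map_mul, hφ, Units.val_one]⟩
    · refine ⟨v * s⁻¹, CayCyl.adj_mul_of_mem S (Or.inl (D.inv_mem s hs)) (inv_ne_one.2 hs1) v, ?_⟩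
      rw [D.map_mul, show D.φ s⁻¹ = -D.φ s from D.cylData.enl.φ_inv s, hφ, Units.val_neg, Units.val_one, Pi.single_neg]
  cyl_connected := fun t ht ℓ hℓ => by
    rw [Finset.mem_singleton] at ht
    subst ht
    have e : {w | D.φ w - D.φ 1 ∈ box 2 ℓ} = D.cylData.enl.V ℓ := by
      ext w; simp [CayCyl.CylData.V, cylData, CayCyl.CylData₁.enl, φ_one]
    rw [e]
    exact D.cylG_connected hℓ

/-- **Φ2 AT AND BELOW `p_c` FOR EVERY `CayleyNeg₁`**: for `p ≤ p_c(Cay(Γ;S))` no cylinder of the skeleton percolates at `p`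
(file VII: `p_c ≤ p_c(C_{ℓ+3}) < p_c(C_{ℓ+2}) ≤ p_c(C_ℓ)`). [cite: AizenmanGrimmett1991, Thm 1 (essential enhancements)] [cite: Menshikov1987, Thm (graph and subgraph)] -/
theorem cylSubcritical_of_le {p : unitInterval} (hp : (p : ℝ) ≤ criticalProb (mulCayley (S : Set Γ)) (1 : Γ)) :
    D.skeleton.CylSubcritical p := by
  intro t ht ℓ
  change t ∈ ({1} : Finset Γ) at ht
  rw [Finset.mem_singleton] at ht
  subst ht
  haveI : Countable Γ := countable_of_connected_of_locallyFinite _ (D.skeleton.graph_connected (1 : Γ)) 1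
  have e : {w | D.skeleton.φ w - D.skeleton.φ 1 ∈ box 2 ℓ} = D.cylData.enl.V ℓ := by
    ext w; simp [CayCyl.CylData.V, cylData, CayCyl.CylData₁.enl, skeleton, φ_one]
  show theta ((mulCayley (S : Set Γ)).induce {w | D.skeleton.φ w - D.skeleton.φ 1 ∈ box 2 ℓ}) ⟨1, _⟩ _ = 0
  rw [theta_induce_congr _ e]
  have h0 := D.cylData.theta_cyl_criticalProb_eq_zero ℓ (D.skeleton.criticalProb_lt_one 1)
  have hmono : theta (D.cylData.cylG ℓ) ⟨1, D.cylData.one_mem_V ℓ⟩ p ≤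
      theta (D.cylData.cylG ℓ) ⟨1, D.cylData.one_mem_V ℓ⟩ (criticalProbIOf (mulCayley (S : Set Γ)) (1 : Γ)) :=
    theta_mono_holds _ _ (Subtype.coe_le_coe.mp hp)
  have hnn : 0 ≤ theta (D.cylData.cylG ℓ) ⟨1, D.cylData.one_mem_V ℓ⟩ p := MeasureTheory.measureReal_nonneg
  linarith

include D in
/-- **CONDITIONAL THEOREM: `θ_g(p) = 0` on `Cay(Γ; S)` for every `p ≤ p_c` and every `CayleyNeg₁`, modulo `SamePDropOfSkeletonNeg₁`**
(letters only; Φ2 derived; `p = p_c` is the content, `p < p_c` is the definition of `p_c`). [cite: BenjaminiSchramm1996, Conj. 4; §2] -/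
theorem theta_eq_zero_of_le_of_negNode₁ (hD : SamePDropOfSkeletonNeg₁) (g : Γ) {p : unitInterval}
    (hp : (p : ℝ) ≤ criticalProb (mulCayley (S : Set Γ)) g) : theta (mulCayley (S : Set Γ)) g p = 0 := by
  haveI : Countable Γ := countable_of_connected_of_locallyFinite _ (D.skeleton.graph_connected g) g
  have hbase : theta (mulCayley (S : Set Γ)) (1 : Γ) (criticalProbIOf (mulCayley (S : Set Γ)) 1) = 0 :=
    continuity_of_negNode₁ hD _ D.skeleton (Finset.mem_singleton_self 1) rfl (D.cylSubcritical_of_le le_rfl)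
  have hθ := theta_iso (leftMulIso S g) (1 : Γ) (criticalProbIOf (mulCayley (S : Set Γ)) 1)
  have hpc := criticalProb_iso (leftMulIso S g) (1 : Γ)
  rw [leftMulIso_apply, mul_one] at hθ hpc
  have e : criticalProbIOf (mulCayley (S : Set Γ)) g = criticalProbIOf (mulCayley (S : Set Γ)) 1 := Subtype.ext hpc
  have hpc0 : theta (mulCayley (S : Set Γ)) g (criticalProbIOf (mulCayley (S : Set Γ)) g) = 0 := by rw [e, hθ]; exact hbase
  have hmono : theta (mulCayley (S : Set Γ)) g p ≤ theta (mulCayley (S : Set Γ)) g (criticalProbIOf (mulCayley (S : Set Γ)) g) :=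
    theta_mono_holds _ _ (Subtype.coe_le_coe.mp hp)
  have hnn : 0 ≤ theta (mulCayley (S : Set Γ)) g p := MeasureTheory.measureReal_nonneg
  linarith

end CayleyNeg₁

/-! ## §2 `CayleySign₁` and the unconditional theorem -/

/-- **INPUT, `(ℤ/2)²` version, letters only**: a `CayleyNeg₁` plus a second `S`-preserving automorphism `κ` with `φκ = (φ₀, −φ₁)`.
[cite: KozmaNitzan2024, §4 p. 16 (Lemma 8)] [cite: BenjaminiSchramm1996, §2; Conj. 4] -/
structure CayleySign₁ (Γ : Type) [Group Γ] (S : Finset Γ) extends CayleyNeg₁ Γ S where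
  /-- the axis flip -/
  κ : Γ ≃* Γ
  /-- `κ` preserves the generating system -/
  κ_mem : ∀ s, κ s ∈ S ↔ s ∈ S
  /-- `φ ∘ κ = flipSnd ∘ φ` -/
  κ_φ : ∀ g, φ (κ g) = flipSnd (φ g)

namespace CayleySign₁

variable {Γ : Type} [Group Γ] {S : Finset Γ} (D : CayleySign₁ Γ S)

/-- **THE SIGN SKELETON OF A `CayleySign₁`.** [cite: KozmaNitzan2024, §4 p. 16 (Lemma 8)] -/
def skeletonSign : PlanarSkeletonSign (mulCayley (S : Set Γ)) where
  toPlanarSkeletonNeg := D.toCayleyNeg₁.skeleton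
  flip := fun t ht => by
    change t ∈ ({1} : Finset Γ) at ht
    rw [Finset.mem_singleton] at ht
    subst ht
    refine ⟨autOfMulEquiv S D.κ D.κ_mem, map_one D.κ, fun w => ?_⟩
    show D.φ (D.κ w) - D.φ 1 = flipSnd (D.φ w - D.φ 1)
    rw [D.toCayleyNeg₁.φ_one, sub_zero, sub_zero, D.κ_φ]

include D in
/-- **THEOREM (unconditional, letters only): `θ_g(p) = 0` for every `p ≤ p_c`, at every vertex of `Cay(Γ; S)`, for every group `Γ` and
symmetric generating system `S` carrying a `CayleySign₁`** — additive planar skeleton of unit range with unit steps, `S`-preserving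
automorphisms acting by `−I` and `diag(1,−1)`, kernel generated by kernel letters and corner-admissible commutator words (every 2-step
nilpotent group whose kernel is generated by kernel letters and commutators of letter pairs); no central element used, no growth hypothesis.
(`p = p_c`: continuity of the phase transition; `p < p_c`: definition of `p_c`.)
builds on p205010 (kernel theorem, internal audit signed; external expert review pending).
[cite: BenjaminiSchramm1996, Conj. 4; §2] [cite: AizenmanGrimmett1991, Thm 1] [cite: KozmaNitzan2024, §1 p. 2 (approach 1)] -/
theorem theta_eq_zero_of_le (g : Γ) {p : unitInterval} (hp : (p : ℝ) ≤ criticalProb (mulCayley (S : Set Γ)) g) :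
    theta (mulCayley (S : Set Γ)) g p = 0 := by
  have hpc0 : theta (mulCayley (S : Set Γ)) g (criticalProbIOf (mulCayley (S : Set Γ)) g) = 0 :=
    PlanarSkeletonSign.criticalContinuity' _ D.skeletonSign
      (fun t ht => by
        have ht' : t = 1 := by
          change t ∈ ({1} : Finset Γ) at ht
          exact Finset.mem_singleton.1 ht
        subst ht'
        exact D.toCayleyNeg₁.cylSubcritical_of_le le_rfl) g
  haveI : Countable Γ := countable_of_connected_of_locallyFinite _ (D.toCayleyNeg₁.skeleton.graph_connected g) g
  have hmono : theta (mulCayley (S : Set Γ)) g p ≤ theta (mulCayley (S : Set Γ)) g (criticalProbIOf (mulCayley (S : Set Γ)) g) :=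
    theta_mono_holds _ _ (Subtype.coe_le_coe.mp hp)
  have hnn : 0 ≤ theta (mulCayley (S : Set Γ)) g p := MeasureTheory.measureReal_nonneg
  linarith

end CayleySign₁

end Summit.CriticalPhenomena.PercolationContinuityZ3.Theorems.Transplant

end
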